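import Literature.Topology.FourManifolds.RegularDomainMaps
import Literature.Topology.FourManifolds.RegularSublevelSet
import Literature.Topology.FourManifolds.GradientLike
import Literature.Topology.FourManifolds.FieldPushforward
import Literature.Topology.FourManifolds.PreliminaryRearrangement
import HarnessLib

/-!
# A diffeomorphism of sublevel sets, read on the ambient manifolds

Topic `Literature/Topology/FourManifolds` (fact seat
`provefact-Literature.Topology.FourManifolds.IsHandlebody.exists_isBoundaryGluing_sphere`, step F2b of
the Lickorish–Wallace DAG; data layer of the handle-extension step of the classification of
handlebodies: the induction hypothesis — a diffeomorphism of the cut stages — enters the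
construction of the lower correspondence as a map between the ambient manifolds).  Everything
here is **proved**; no named facts.

Let `Ψ₀ : {f ≤ a} ≅ {f' ≤ a'}` be a diffeomorphism of regular sublevel sets (structures
`sublevelAtlas`, `RegularSublevelSet.lean`) of two manifolds with boundary.  Then:

* `Literature.Topology.FourManifolds.sublevelAmbient Ψ₀ d` — the map `M → M'` equal to `Ψ₀` on
  `{f ≤ a}` (and to the junk value `d` elsewhere); it is smooth on the open set `{f < a}`
  (`contMDiffOn_sublevelAmbient`, by `HalfSliceAtlas.contMDiffAt_codRestrict`, Lee 2013,
  Cor. 5.30), inverted there by the ambient map of `Ψ₀⁻¹` (`sublevelAmbient_symm_apply`);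
* level compatibility transfers (`apply_sublevelAmbient_eq`), and a **symmetric collar**: if
  `f' ∘ Ψ₀ = f + σ` on a collar `{a - f < s₁}` of the boundary `{f = a}` then also
  `f ∘ Ψ₀⁻¹ = f' - σ` on some collar of `{f' = a'}` (`exists_collar_symm`, compactness and the
  invariance of the boundary `Diffeomorph.preimage_boundary`), whence deep points go to deep
  points (`apply_sublevelAmbient_le`);
* **the pulled-back field** `VectorField.mpullback` of a smooth field `X'` along the ambient map
  on the band `{a - s < f < a}`: smooth (`contMDiffOn_mpullback_sublevelAmbient`, Mathlib's
  `ContMDiffAt.mpullback_vectorField_preimage`), related to `X'` by the differential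
  (`mfderiv_sublevelAmbient_mpullback`), and of unit speed for `f` where `X'` has unit speed
  for `f'` (`mlineDeriv_mpullback_sublevelAmbient`).

## References

* J. M. Lee, *Introduction to Smooth Manifolds*, 2nd ed. (2013), Cor. 5.30, Prop. 8.19
  (pushforwards of vector fields along diffeomorphisms). [LeeSmoothManifolds2013]
* J. Milnor, *Lectures on the h-cobordism theorem* (1965), Lemma 2.9. [MilnorHCobordism1965]
-/

open scoped Manifold ContDiff Topology
open Set Function Filter Metric

noncomputable section

namespace Literature.Topology.FourManifolds

universe u

variable {k : ℕ} {M : Type u} [TopologicalSpace M] [ChartedSpace (EuclideanHalfSpace (k + 1)) M]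
  [IsManifold (𝓡∂ (k + 1)) ∞ M]
  {M' : Type u} [TopologicalSpace M'] [ChartedSpace (EuclideanHalfSpace (k + 1)) M']
  [IsManifold (𝓡∂ (k + 1)) ∞ M']
  {f : M → ℝ} {hf : ContMDiff (𝓡∂ (k + 1)) 𝓘(ℝ, ℝ) ∞ f} {a : ℝ}
  {hint : ∀ p, f p ≤ a → (𝓡∂ (k + 1)).IsInteriorPoint p}
  {hreg : ∀ p, f p = a → ¬ IsMCriticalPt (𝓡∂ (k + 1)) f p}
  {f' : M' → ℝ} {hf' : ContMDiff (𝓡∂ (k + 1)) 𝓘(ℝ, ℝ) ∞ f'} {a' : ℝ}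
  {hint' : ∀ p, f' p ≤ a' → (𝓡∂ (k + 1)).IsInteriorPoint p}
  {hreg' : ∀ p, f' p = a' → ¬ IsMCriticalPt (𝓡∂ (k + 1)) f' p}

section Ambient

omit [TopologicalSpace M] [TopologicalSpace M'] in
/-- **A map of sublevel sets read on the ambient manifold**: `Ψ₀` on `{f ≤ a}`, the junk value
`d` elsewhere. [folklore] -/
def sublevelAmbient (Ψ₀ : ↥(f ⁻¹' Iic a) → ↥(f' ⁻¹' Iic a')) (d : M') (x : M) : M' := by
  classical
  exact if h : f x ≤ a then (Ψ₀ ⟨x, h⟩).1 else d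

variable {Ψ₀ : ↥(f ⁻¹' Iic a) → ↥(f' ⁻¹' Iic a')} {d : M'}

omit [TopologicalSpace M] [TopologicalSpace M'] in
/-- The ambient map on `{f ≤ a}`. [folklore] -/
theorem sublevelAmbient_apply {x : M} (h : f x ≤ a) : sublevelAmbient Ψ₀ d x = (Ψ₀ ⟨x, h⟩).1 := by
  simp [sublevelAmbient, h]

omit [TopologicalSpace M] [TopologicalSpace M'] in
/-- The ambient map takes `{f ≤ a}` into `{f' ≤ a'}`. [folklore] -/
theorem apply_sublevelAmbient_le {x : M} (h : f x ≤ a) : f' (sublevelAmbient Ψ₀ d x) ≤ a' := by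
  rw [sublevelAmbient_apply h]; exact (Ψ₀ ⟨x, h⟩).2

variable [csW : ChartedSpace (EuclideanHalfSpace (k + 1)) ↥(f ⁻¹' Iic a)]
  [csW' : ChartedSpace (EuclideanHalfSpace (k + 1)) ↥(f' ⁻¹' Iic a')]

/-- **The ambient map is smooth on `{f < a}`** (Lee 2013, Cor. 5.30: read `x ↦ Ψ₀ ⟨x, _⟩` as
the corestriction of a map smooth at `x`, then compose with the inclusion); the manifold
structures of the sublevel sets are the ones of `sublevelAtlas` (hypotheses `hcs`, `hcs'`, so
that the structures carried by the types may be definitional unfoldings of them).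
[cite: LeeSmoothManifolds2013, Cor. 5.30] -/
theorem contMDiffOn_sublevelAmbient (hk : 1 ≤ k) (hcs : csW = (sublevelAtlas hf a hint hreg).chartedSpace)
    (hcs' : csW' = (sublevelAtlas hf' a' hint' hreg').chartedSpace)
    (hΨ : ContMDiff (𝓡∂ (k + 1)) (𝓡∂ (k + 1)) ∞ Ψ₀) :
    ContMDiffOn (𝓡∂ (k + 1)) (𝓡∂ (k + 1)) ∞ (sublevelAmbient Ψ₀ d) {x | f x < a} := by
  subst hcs hcs'
  letI := (sublevelAtlas hf a hint hreg).chartedSpace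
  letI := (sublevelAtlas hf' a' hint' hreg').chartedSpace
  haveI := (sublevelAtlas hf a hint hreg).isManifold
  haveI := (sublevelAtlas hf' a' hint' hreg').isManifold
  intro x hx
  have hxa : f x < a := hx
  apply ContMDiffAt.contMDiffWithinAt
  classical
  -- the auxiliary map `g y = y` on `{f ≤ a}`, `= x` elsewhere, lands in `{f ≤ a}`
  set g : M → M := fun y => if f y ≤ a then y else x with hg
  have hgS : ∀ y, g y ∈ f ⁻¹' Iic a := fun y => by
    by_cases h : f y ≤ a
    · simp only [hg, if_pos h]; exact h
    · simp only [hg, if_neg h]; exact hxa.le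
  have hopen : IsOpen {y : M | f y < a} := isOpen_lt hf.continuous continuous_const
  have hgid : g =ᶠ[𝓝 x] id := by
    filter_upwards [hopen.mem_nhds hxa] with y hy
    simp only [hg, if_pos (le_of_lt hy), id]
  have hgx : ContMDiffAt (𝓡∂ (k + 1)) (𝓡∂ (k + 1)) ∞ g x := contMDiffAt_id.congr_of_eventuallyEq hgid
  have hcod := (sublevelAtlas hf a hint hreg).contMDiffAt_codRestrict hgS hgx
  have hcomp : ContMDiffAt (𝓡∂ (k + 1)) (𝓡∂ (k + 1)) ∞
      (fun y => (Ψ₀ ((f ⁻¹' Iic a).codRestrict g hgS y)).1) x :=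
    (((sublevelAtlas hf' a' hint' hreg').contMDiff_subtype_val hk).comp hΨ).contMDiffAt.comp x hcod
  refine hcomp.congr_of_eventuallyEq ?_
  filter_upwards [hopen.mem_nhds hxa] with y hy
  rw [sublevelAmbient_apply hy.le]
  congr 2
  apply Subtype.ext
  simp only [val_codRestrict_apply, hg, if_pos (le_of_lt hy)]

end Ambient

section Diffeo

variable [csW : ChartedSpace (EuclideanHalfSpace (k + 1)) ↥(f ⁻¹' Iic a)]
  [csW' : ChartedSpace (EuclideanHalfSpace (k + 1)) ↥(f' ⁻¹' Iic a')]
  (Ψ₀ : ↥(f ⁻¹' Iic a) ≃ₘ⟮𝓡∂ (k + 1), 𝓡∂ (k + 1)⟯ ↥(f' ⁻¹' Iic a'))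

omit [ChartedSpace (EuclideanHalfSpace (k + 1)) M] [IsManifold (𝓡∂ (k + 1)) ∞ M]
  [ChartedSpace (EuclideanHalfSpace (k + 1)) M'] [IsManifold (𝓡∂ (k + 1)) ∞ M'] in
/-- **The ambient maps of `Ψ₀` and `Ψ₀⁻¹` are inverse on `{f ≤ a}`.** [folklore] -/
theorem sublevelAmbient_symm_apply {d : M'} {d₀ : M} {x : M} (h : f x ≤ a) :
    sublevelAmbient (f := f') (a := a') (f' := f) (a' := a) Ψ₀.symm d₀ (sublevelAmbient Ψ₀ d x) = x := by
  rw [sublevelAmbient_apply h]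
  rw [sublevelAmbient_apply (Ψ₀ ⟨x, h⟩).2]
  simp

omit [ChartedSpace (EuclideanHalfSpace (k + 1)) M] [IsManifold (𝓡∂ (k + 1)) ∞ M]
  [ChartedSpace (EuclideanHalfSpace (k + 1)) M'] [IsManifold (𝓡∂ (k + 1)) ∞ M'] in
/-- **Level compatibility transfers to the ambient map.** [folklore] -/
theorem apply_sublevelAmbient_eq {d : M'} {σ s₁ : ℝ}
    (hΨ : ∀ y : ↥(f ⁻¹' Iic a), a - f y.1 < s₁ → f' (Ψ₀ y).1 = f y.1 + σ) {x : M} (h : f x ≤ a)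
    (hx : a - f x < s₁) : f' (sublevelAmbient Ψ₀ d x) = f x + σ := by
  rw [sublevelAmbient_apply h]; exact hΨ ⟨x, h⟩ hx

/-- **The symmetric collar**: on compact sublevel sets, if `f' ∘ Ψ₀ = f + σ` on the collar
`{a - f < s₁}` and `a' = a + σ`, then `f ∘ Ψ₀⁻¹ = f' - σ` on some collar `{a' - f' < s₁'}`
(the image of the collar is an open neighbourhood of the boundary `{f' = a'}`, which the
diffeomorphism preserves, `Diffeomorph.preimage_boundary`; compactness gives a uniform collar
inside it). [folklore] -/
theorem exists_collar_symm (hcs : csW = (sublevelAtlas hf a hint hreg).chartedSpace)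
    (hcs' : csW' = (sublevelAtlas hf' a' hint' hreg').chartedSpace) (hcpt' : IsCompact (f' ⁻¹' Iic a'))
    {σ s₁ : ℝ} (hs₁ : 0 < s₁)
    (hΨ : ∀ y : ↥(f ⁻¹' Iic a), a - f y.1 < s₁ → f' (Ψ₀ y).1 = f y.1 + σ) :
    ∃ s₁' : ℝ, 0 < s₁' ∧ ∀ z : ↥(f' ⁻¹' Iic a'), a' - f' z.1 < s₁' → f (Ψ₀.symm z).1 = f' z.1 - σ := by
  subst hcs hcs'
  letI := (sublevelAtlas hf a hint hreg).chartedSpace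
  letI := (sublevelAtlas hf' a' hint' hreg').chartedSpace
  haveI := (sublevelAtlas hf a hint hreg).isManifold
  haveI := (sublevelAtlas hf' a' hint' hreg').isManifold
  haveI : CompactSpace ↥(f' ⁻¹' Iic a') := isCompact_iff_compactSpace.1 hcpt'
  -- the image of the collar
  set U : Set ↥(f' ⁻¹' Iic a') := Ψ₀.symm ⁻¹' {y | a - f y.1 < s₁} with hU
  have hcont : Continuous fun y : ↥(f ⁻¹' Iic a) => a - f y.1 :=
    continuous_const.sub (hf.continuous.comp continuous_subtype_val)
  have hUo : IsOpen U := (isOpen_lt hcont continuous_const).preimage Ψ₀.symm.continuous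
  -- points outside `U` are interior, hence `f' < a'` there
  have hbd : Ψ₀.symm ⁻¹' (𝓡∂ (k + 1)).boundary ↥(f ⁻¹' Iic a) = (𝓡∂ (k + 1)).boundary ↥(f' ⁻¹' Iic a') :=
    Ψ₀.symm.preimage_boundary (by simp)
  have h1 : ∀ z : ↥(f' ⁻¹' Iic a'), z ∉ U → f' z.1 < a' := by
    intro z hz
    refine lt_of_le_of_ne z.2 fun heq => hz ?_
    have hzb : (𝓡∂ (k + 1)).IsBoundaryPoint z := (isBoundaryPoint_sublevel_iff hf' a' hint' hreg' z).2 heq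
    have hyb : Ψ₀.symm z ∈ (𝓡∂ (k + 1)).boundary ↥(f ⁻¹' Iic a) := by
      show z ∈ Ψ₀.symm ⁻¹' (𝓡∂ (k + 1)).boundary ↥(f ⁻¹' Iic a)
      rw [hbd]; exact hzb
    have hya : f (Ψ₀.symm z).1 = a := (isBoundaryPoint_sublevel_iff hf a hint hreg _).1 hyb
    show a - f (Ψ₀.symm z).1 < s₁
    rw [hya, sub_self]; exact hs₁
  -- a uniform collar inside `U`
  obtain ⟨s₁', hs₁', hcollar⟩ : ∃ s₁' : ℝ, 0 < s₁' ∧ ∀ z : ↥(f' ⁻¹' Iic a'), a' - f' z.1 < s₁' → z ∈ U := by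
    have hKc : IsCompact Uᶜ := hUo.isClosed_compl.isCompact
    rcases (Uᶜ : Set ↥(f' ⁻¹' Iic a')).eq_empty_or_nonempty with hKe | hKne
    · refine ⟨1, one_pos, fun z _ => ?_⟩
      by_contra hz
      have : z ∈ (Uᶜ : Set _) := hz
      rw [hKe] at this; exact this
    · have hc' : Continuous fun z : ↥(f' ⁻¹' Iic a') => f' z.1 := hf'.continuous.comp continuous_subtype_val
      obtain ⟨z₀, hz₀, hmax⟩ := hKc.exists_isMaxOn hKne hc'.continuousOn
      refine ⟨a' - f' z₀.1, by linarith [h1 z₀ hz₀], fun z hz => ?_⟩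
      by_contra hzU
      have := hmax (show z ∈ Uᶜ from hzU)
      simp only [mem_setOf_eq] at this
      linarith
  refine ⟨s₁', hs₁', fun z hz => ?_⟩
  have hy : a - f (Ψ₀.symm z).1 < s₁ := hcollar z hz
  have h := hΨ (Ψ₀.symm z) hy
  rw [Diffeomorph.apply_symm_apply] at h
  linarith

omit [ChartedSpace (EuclideanHalfSpace (k + 1)) M] [IsManifold (𝓡∂ (k + 1)) ∞ M]
  [ChartedSpace (EuclideanHalfSpace (k + 1)) M'] [IsManifold (𝓡∂ (k + 1)) ∞ M'] in
/-- **Deep points go to deep points**: with the symmetric collar of width `s₁'`, a point of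
depth `≥ s` (`s ≤ s₁'`) is mapped to a point of depth `≥ s`. [folklore] -/
theorem le_of_apply_symm {σ s₁' s : ℝ} (hs : s ≤ s₁')
    (hΨ' : ∀ z : ↥(f' ⁻¹' Iic a'), a' - f' z.1 < s₁' → f (Ψ₀.symm z).1 = f' z.1 - σ)
    (hσ : a' = a + σ) {x : ↥(f ⁻¹' Iic a)} (hx : f x.1 ≤ a - s) : f' (Ψ₀ x).1 ≤ a' - s := by
  by_contra hlt
  push Not at hlt
  have h := hΨ' (Ψ₀ x) (by linarith)
  rw [Diffeomorph.symm_apply_apply] at h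
  linarith

end Diffeo

/-! ### The pulled-back field along the ambient map -/

section Pullback

variable [csW : ChartedSpace (EuclideanHalfSpace (k + 1)) ↥(f ⁻¹' Iic a)]
  [csW' : ChartedSpace (EuclideanHalfSpace (k + 1)) ↥(f' ⁻¹' Iic a')]
  (Ψ₀ : ↥(f ⁻¹' Iic a) ≃ₘ⟮𝓡∂ (k + 1), 𝓡∂ (k + 1)⟯ ↥(f' ⁻¹' Iic a')) (d : M') (d₀ : M)

/-- The ambient map of `Ψ₀`. [folklore] -/
abbrev amb : M → M' := sublevelAmbient Ψ₀ d

/-- The ambient map of `Ψ₀⁻¹`. [folklore] -/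
abbrev ambInv : M' → M := sublevelAmbient (f := f') (a := a') (f' := f) (a' := a) Ψ₀.symm d₀

variable {Ψ₀ d d₀} (hk : 1 ≤ k) (hcs : csW = (sublevelAtlas hf a hint hreg).chartedSpace)
    (hcs' : csW' = (sublevelAtlas hf' a' hint' hreg').chartedSpace)

omit [ChartedSpace (EuclideanHalfSpace (k + 1)) M] [IsManifold (𝓡∂ (k + 1)) ∞ M]
  [ChartedSpace (EuclideanHalfSpace (k + 1)) M'] [IsManifold (𝓡∂ (k + 1)) ∞ M'] in
/-- `ambInv ∘ amb = id` near a point of `{f < a}`. [folklore] -/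
theorem ambInv_comp_amb_eventuallyEq (hfc : Continuous f) {x : M} (hx : f x < a) :
    (ambInv Ψ₀ d₀) ∘ (amb Ψ₀ d) =ᶠ[𝓝 x] id := by
  filter_upwards [(isOpen_lt hfc continuous_const).mem_nhds hx] with y hy
  exact sublevelAmbient_symm_apply Ψ₀ hy.le

omit [ChartedSpace (EuclideanHalfSpace (k + 1)) M] [IsManifold (𝓡∂ (k + 1)) ∞ M]
  [ChartedSpace (EuclideanHalfSpace (k + 1)) M'] [IsManifold (𝓡∂ (k + 1)) ∞ M'] in
/-- `amb ∘ ambInv = id` near a point of `{f' < a'}`. [folklore] -/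
theorem amb_comp_ambInv_eventuallyEq (hfc' : Continuous f') {z : M'} (hz : f' z < a') :
    (amb Ψ₀ d) ∘ (ambInv Ψ₀ d₀) =ᶠ[𝓝 z] id := by
  filter_upwards [(isOpen_lt hfc' continuous_const).mem_nhds hz] with w hw
  show sublevelAmbient Ψ₀ d (sublevelAmbient Ψ₀.symm d₀ w) = w
  rw [sublevelAmbient_apply hw.le, sublevelAmbient_apply (Ψ₀.symm ⟨w, hw.le⟩).2]
  simp

include hk hcs hcs' in
/-- `amb` is smooth at points of `{f < a}`. [cite: LeeSmoothManifolds2013, Cor. 5.30] -/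
theorem contMDiffAt_amb {x : M} (hx : f x < a) : ContMDiffAt (𝓡∂ (k + 1)) (𝓡∂ (k + 1)) ∞ (amb Ψ₀ d) x := by
  have hmf : IsManifold (𝓡∂ (k + 1)) ∞ ↥(f ⁻¹' Iic a) := by subst hcs; exact (sublevelAtlas hf a hint hreg).isManifold
  have hmf' : IsManifold (𝓡∂ (k + 1)) ∞ ↥(f' ⁻¹' Iic a') := by subst hcs'; exact (sublevelAtlas hf' a' hint' hreg').isManifold
  exact (contMDiffOn_sublevelAmbient hk hcs hcs' Ψ₀.contMDiff).contMDiffAt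
    ((isOpen_lt hf.continuous continuous_const).mem_nhds hx)

include hk hcs hcs' in
/-- `ambInv` is smooth at points of `{f' < a'}`. [cite: LeeSmoothManifolds2013, Cor. 5.30] -/
theorem contMDiffAt_ambInv {z : M'} (hz : f' z < a') :
    ContMDiffAt (𝓡∂ (k + 1)) (𝓡∂ (k + 1)) ∞ (ambInv Ψ₀ d₀) z := by
  have hmf : IsManifold (𝓡∂ (k + 1)) ∞ ↥(f ⁻¹' Iic a) := by subst hcs; exact (sublevelAtlas hf a hint hreg).isManifold
  have hmf' : IsManifold (𝓡∂ (k + 1)) ∞ ↥(f' ⁻¹' Iic a') := by subst hcs'; exact (sublevelAtlas hf' a' hint' hreg').isManifold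
  exact (contMDiffOn_sublevelAmbient hk hcs' hcs Ψ₀.symm.contMDiff).contMDiffAt
    ((isOpen_lt hf'.continuous continuous_const).mem_nhds hz)

include hk hcs hcs' in
/-- **The differential of the ambient map is invertible on `{f < a}` at points mapped into
`{f' < a'}`** (local inverse pair `(amb, ambInv)`). [folklore] -/
theorem isInvertible_mfderiv_amb [T2Space M] [T2Space M'] {x : M} (hx : f x < a)
    (hx' : f' (amb Ψ₀ d x) < a') :
    (mfderiv (𝓡∂ (k + 1)) (𝓡∂ (k + 1)) (amb Ψ₀ d) x).IsInvertible :=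
  isInvertible_mfderiv_of_eventuallyEq' ((contMDiffAt_amb hk hcs hcs' hx).mdifferentiableAt (by simp))
    ((contMDiffAt_ambInv (d₀ := x) hk hcs hcs' hx').mdifferentiableAt (by simp))
    (ambInv_comp_amb_eventuallyEq hf.continuous hx) (amb_comp_ambInv_eventuallyEq hf'.continuous hx')

include hk hcs hcs' in
/-- **The pulled-back field is related to the original field by the differential.** [cite: LeeSmoothManifolds2013, Prop. 8.19] -/
theorem mfderiv_amb_mpullback [T2Space M] [T2Space M'] (X' : Π y : M', TangentSpace (𝓡∂ (k + 1)) y)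
    {x : M} (hx : f x < a) (hx' : f' (amb Ψ₀ d x) < a') :
    mfderiv (𝓡∂ (k + 1)) (𝓡∂ (k + 1)) (amb Ψ₀ d) x
      (VectorField.mpullback (𝓡∂ (k + 1)) (𝓡∂ (k + 1)) (amb Ψ₀ d) X' x) = X' (amb Ψ₀ d x) := by
  rw [VectorField.mpullback_apply]
  obtain ⟨A, hA⟩ := isInvertible_mfderiv_amb hk hcs hcs' hx hx'
  rw [← hA, ContinuousLinearMap.inverse_equiv]
  exact A.apply_symm_apply _

include hk hcs hcs' in
/-- **The pulled-back field is smooth on the band** `{a - s < f < a}` when the ambient map takes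
it into `{f' < a'}` (Mathlib's `ContMDiffAt.mpullback_vectorField_preimage`).
[cite: LeeSmoothManifolds2013, Prop. 8.19] -/
theorem contMDiffOn_mpullback_amb [T2Space M] [T2Space M']
    {X' : Π y : M', TangentSpace (𝓡∂ (k + 1)) y}
    (hX' : ContMDiff (𝓡∂ (k + 1)) (𝓡∂ (k + 1)).tangent ∞ fun y => (⟨y, X' y⟩ : TangentBundle (𝓡∂ (k + 1)) M'))
    {U : Set M} (hU : ∀ x ∈ U, f x < a ∧ f' (amb Ψ₀ d x) < a') :
    ContMDiffOn (𝓡∂ (k + 1)) (𝓡∂ (k + 1)).tangent ∞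
      (fun x => (⟨x, VectorField.mpullback (𝓡∂ (k + 1)) (𝓡∂ (k + 1)) (amb Ψ₀ d) X' x⟩ :
        TangentBundle (𝓡∂ (k + 1)) M)) U := by
  intro x hx
  apply ContMDiffAt.contMDiffWithinAt
  exact ContMDiffAt.mpullback_vectorField_preimage hX'.contMDiffAt (contMDiffAt_amb hk hcs hcs' (hU x hx).1)
    (isInvertible_mfderiv_amb hk hcs hcs' (hU x hx).1 (hU x hx).2) (by simp)

include hk hcs hcs' in
/-- **Unit speed of the pulled-back field**: if `f' ∘ amb = f + σ` near `x` and `X'` has unit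
speed for `f'` at `amb x`, then the pulled-back field has unit speed for `f` at `x`
(`v(f) = (d amb · v)(f ∘ ambInv) = X'(f' - σ) = X'(f') = 1`).
[cite: MilnorHCobordism1965, proof of Thm. 3.4 (PDF p. 13)] -/
theorem mlineDeriv_mpullback_amb [T2Space M] [T2Space M']
    (X' : Π y : M', TangentSpace (𝓡∂ (k + 1)) y) {σ : ℝ} {x : M} (hx : f x < a)
    (hx' : f' (amb Ψ₀ d x) < a') (hev : ∀ᶠ y in 𝓝 x, f' (amb Ψ₀ d y) = f y + σ)
    (hunit : mlineDeriv (𝓡∂ (k + 1)) f' (amb Ψ₀ d x) (X' (amb Ψ₀ d x)) = 1) :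
    mlineDeriv (𝓡∂ (k + 1)) f x (VectorField.mpullback (𝓡∂ (k + 1)) (𝓡∂ (k + 1)) (amb Ψ₀ d) X' x) = 1 := by
  have hΨ := (contMDiffAt_amb (Ψ₀ := Ψ₀) (d := d) hk hcs hcs' hx).mdifferentiableAt (by simp)
  have hΦ := (contMDiffAt_ambInv (Ψ₀ := Ψ₀) (d₀ := x) hk hcs hcs' hx').mdifferentiableAt (by simp)
  have h₁ := ambInv_comp_amb_eventuallyEq (Ψ₀ := Ψ₀) (d := d) (d₀ := x) hf.continuous hx
  have h₂ := amb_comp_ambInv_eventuallyEq (Ψ₀ := Ψ₀) (d := d) (d₀ := x) hf'.continuous hx'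
  rw [mlineDeriv_def, mfderiv_apply_mpullback hΨ hΦ h₁ h₂ (hf.mdifferentiableAt (by simp)) X']
  -- `f ∘ ambInv = f' - σ` near `amb x`
  have hcont : ContinuousAt (ambInv Ψ₀ x) (amb Ψ₀ d x) := hΦ.continuousAt
  have hx₀ : ambInv Ψ₀ x (amb Ψ₀ d x) = x := sublevelAmbient_symm_apply Ψ₀ hx.le
  have hev' : ∀ᶠ z in 𝓝 (amb Ψ₀ d x), f' (amb Ψ₀ d (ambInv Ψ₀ x z)) = f (ambInv Ψ₀ x z) + σ := by
    have : Tendsto (ambInv Ψ₀ x) (𝓝 (amb Ψ₀ d x)) (𝓝 x) := by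
      have h := hcont.tendsto; rwa [hx₀] at h
    exact this.eventually hev
  have hfΦ : f ∘ ambInv Ψ₀ x =ᶠ[𝓝 (amb Ψ₀ d x)] fun z => (fun t => t - σ) (f' z) := by
    filter_upwards [hev', h₂] with z hz hz2
    have hz2' : amb Ψ₀ d (ambInv Ψ₀ x z) = z := hz2
    rw [hz2'] at hz
    show f (ambInv Ψ₀ x z) = f' z - σ
    linarith
  rw [hfΦ.mfderiv_eq]
  have h := mlineDeriv_real_comp (I := 𝓡∂ (k + 1)) (f := f') (φ := fun t => t - σ) (d := 1)
    ((hasDerivAt_id _).sub_const σ) (hf'.mdifferentiableAt (by simp)) (X' (amb Ψ₀ d x))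
  rw [mlineDeriv_def, mlineDeriv_def, one_mul] at h
  rw [mlineDeriv_def] at hunit
  exact h.trans hunit

end Pullback

end Literature.Topology.FourManifolds
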